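import Literature.AnabelianGeometry.AbsoluteAnabelian.ArchimedeanHolFieldFunctorGeometricUpperHalfPlane
import Literature.AnabelianGeometry.AbsoluteAnabelian.ArchimedeanHolFieldFunctorGeometricCovers
import Literature.Topology.CoveringSpaces.UniformizedConnectedCovers
import Literature.Geometry.Manifold.QuotientMaps
import Literature.Geometry.Kaehler.RiemannSurfaceStructurePullbackRigidity
import HarnessLib

/-!
# Every Riemann surface finite étale over `ℍ/Γ` is an `ℍ/Λ`, `Λ ≤ Γ` of finite index (PROOF-ONLY)

Topic `Literature/AnabelianGeometry/AbsoluteAnabelian`; campaign-L item R1.2 / junction J1 of the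
geometric `EA` column of [AbsTopIII] Prop 4.2 (i): print (kurims p.106 l.11–19, JMS 22 p.1079) reads
«the full subcategory of `EA` consisting of objects that map to `X` may … be identified with the category
of finite étale R-localizations `Loc_R(X)`».  With the uniformised objects `ℍ/Λ` and morphisms
`[τ] ↦ [γ • τ]` of abc-iut-L4-t14 (`HolRS.fuchsianQuotient`, `fuchsianQuotientHom`, FULLNESS
`exists_sl_of_hom` over `UniformizedLift.exists_sl_lift`), the remaining half of that identification is
ESSENTIAL SURJECTIVITY: every object of `HolRS` over `ℍ/Γ` is one of the `ℍ/Λ`.  This file proves it, as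
the `HolRS`-level packaging of the topological classification
`SimplyConnectedCover.exists_subgroup_homeomorph_orbitQuotient` (`UniformizedConnectedCovers`,
Hatcher Thm. 1.38 / Ex. 24) and the rigidity of induced complex structures
(`RiemannSurfaceStructurePullbackRigidity`, Lin (7.5.2.1) / Forster 4.6):

* `HolRS.exists_subgroup_cover_of_hom` — chart-free form: for `p : Y ⟶ ℍ/Γ` there are `Λ ≤ Γ` of
  finite index (with its membership criterion), a HOLOMORPHIC covering map `k : ℍ → Y` over `ℍ/Γ` and a
  homeomorphism `e : ℍ/Λ ≃ₜ Y` with `e [τ] = k τ`;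
* **`HolRS.exists_fuchsianQuotient_iso_of_hom`** — `Λ` acts freely and properly discontinuously and
  `e` is an ISOMORPHISM `fuchsianQuotient Λ ≅ Y` of `HolRS` over `ℍ/Γ` (`p (e [τ]) = [τ]`): holomorphy of
  `e` by descent along `ℍ → ℍ/Λ` (`QuotientManifold.mdifferentiable_comp_mk_iff`), of `e⁻¹` because a
  bijective holomorphic local homeomorphism of Riemann surfaces is a biholomorphism
  (`isLocalDiffeomorph_of_mdifferentiable_of_isLocalHomeomorph`, `IsLocalDiffeomorph.diffeomorphOfBijective`).

Everything is a theorem; no definition, no named fact; the hypotheses on `Γ` are those of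
`fuchsianQuotient`.  MODEL ≠ reconstruction; nothing here bears on [IUTchIII] Cor. 3.12.

## References

* S. Mochizuki, *Topics in Absolute Anabelian Geometry III* (2015), proof of Prop. 4.2 (i), p.106.
  [MochizukiAbsTopIII2015]
* A. Hatcher, *Algebraic Topology* (2002), §1.3 Thm. 1.38, Ex. 24. [HatcherAT2002]
-/

noncomputable section

namespace Literature.AnabelianGeometry.AbsoluteAnabelian

namespace HolRS

open scoped _root_.Manifold _root_.ContDiff _root_.Topology MatrixGroups UpperHalfPlane
open _root_.MulAction _root_.Function _root_.Set _root_.CategoryTheory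
open Literature.Topology.CoveringSpaces Literature.Geometry.Manifold

variable (Γ : Subgroup SL(2, ℝ)) [ProperlyDiscontinuousSMul Γ ℍ] [IsCancelSMul Γ ℍ]
  (Y : HolRS) (p : Y ⟶ fuchsianQuotient Γ)

/-- **Every Riemann surface finite étale over `ℍ/Γ` is uniformised by `ℍ` as a quotient `ℍ/Λ`,
`Λ ≤ Γ` of finite index** (chart-free form): for `p : Y ⟶ ℍ/Γ` in `HolRS` there are a subgroup
`Λ ≤ Γ` of finite index — with the membership criterion `γ ∈ Λ ↔ γ ∈ Γ ∧ k ∘ (γ • ·) = k` —, a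
HOLOMORPHIC covering map `k : ℍ → Y` with `p ∘ k = [·]_Γ`, and a homeomorphism `e : ℍ/Λ ≃ₜ Y` with
`e [τ] = k τ` (Hatcher Thm. 1.38 / Ex. 24 via `SimplyConnectedCover.exists_subgroup_homeomorph_orbitQuotient`;
holomorphy of `k` by rigidity over `ℍ/Γ`). [cite: MochizukiAbsTopIII2015, Proposition 4.2 (i) proof p.106]
[cite: HatcherAT2002, §1.3 Theorem 1.38 and Exercise 24] -/
theorem exists_subgroup_cover_of_hom :
    ∃ (Λ : Subgroup SL(2, ℝ)) (k : ℍ → Y.carrier) (e : orbitRel.Quotient Λ ℍ ≃ₜ Y.carrier),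
      Λ ≤ Γ ∧ (Λ.subgroupOf Γ).FiniteIndex ∧ IsCoveringMap k ∧ MDifferentiable 𝓘(ℂ, ℂ) 𝓘(ℂ, ℂ) k ∧
      (∀ τ : ℍ, p.toFun (k τ) = Quotient.mk (orbitRel Γ ℍ) τ) ∧
      (∀ γ, γ ∈ Λ ↔ γ ∈ Γ ∧ ∀ τ : ℍ, k (γ • τ) = k τ) ∧
      (∀ τ τ' : ℍ, k τ = k τ' ↔ ∃ γ ∈ Λ, γ • τ = τ') ∧
      (∀ τ : ℍ, e (Quotient.mk _ τ) = k τ) := by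
  -- the uniformisation `π : ℍ → ℍ/Γ`, read on the carrier of `fuchsianQuotient Γ`
  let π : ℍ → (fuchsianQuotient Γ).carrier := Quotient.mk (orbitRel Γ ℍ)
  have hπ : IsCoveringMap π :=
    (isQuotientCoveringMap_quotientMk_of_properlyDiscontinuousSMul (G := Γ) (E := ℍ)).isCoveringMap
  have dπ : MDifferentiable 𝓘(ℂ, ℂ) 𝓘(ℂ, ℂ) π :=
    (QuotientManifold.contMDiff_mk (G := Γ) (n := ω)
      (fun k => contMDiff_sl_smul (k : SL(2, ℝ)))).mdifferentiable (by simp)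
  have hdeck : ∀ μ ∈ Γ, ∀ τ : ℍ, π (μ • τ) = π τ := fun μ hμ τ => Quotient.sound ⟨⟨μ, hμ⟩, rfl⟩
  have horb : ∀ τ τ' : ℍ, π τ = π τ' → ∃ μ ∈ Γ, μ • τ = τ' := by
    intro τ τ' h
    obtain ⟨m, hm⟩ := Quotient.exact h
    exact ⟨((m⁻¹ : Γ) : SL(2, ℝ)), (m⁻¹).2, by rw [← hm]; exact inv_smul_smul m τ'⟩
  haveI : LocallyConnectedSpace (fuchsianQuotient Γ).carrier := ChartedSpace.locallyConnectedSpace ℂ _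
  obtain ⟨y₀⟩ := (inferInstance : Nonempty Y.carrier)
  obtain ⟨m₀, hm₀⟩ := Quotient.exists_rep (p.toFun y₀)
  have h0 : p.toFun y₀ = π m₀ := hm₀.symm
  obtain ⟨Λ, k, e, hΛΓ, hk, hpk, -, hΛ, hfib, hek, -, -⟩ :=
    SimplyConnectedCover.exists_subgroup_homeomorph_orbitQuotient (N := SL(2, ℝ)) (Γ := Γ) (p := p.toFun)
      hπ hdeck horb p.isFiniteEtale.isCoveringMap h0
  have hfin : (Λ.subgroupOf Γ).FiniteIndex :=
    SimplyConnectedCover.finiteIndex_of_finite_fibre p.isFiniteEtale.isCoveringMap hk.continuous hpk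
      hdeck hΛ m₀ (p.isFiniteEtale.finite_fibre _)
  have hpk' : p.toFun ∘ k = π := funext hpk
  have dk : MDifferentiable 𝓘(ℂ, ℂ) 𝓘(ℂ, ℂ) k :=
    Literature.Geometry.Kaehler.mdifferentiable_of_comp_eq (X := (fuchsianQuotient Γ).carrier)
      (p := π) (q := p.toFun) (f := k) dπ
      (isLocalDiffeomorph_of_mdifferentiable_of_isLocalHomeomorph p.mdifferentiable p.isLocalHomeomorph)
      hk.continuous hpk'
  exact ⟨Λ, k, e, hΛΓ, hfin, hk, dk, hpk, hΛ, hfib, hek⟩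

/-- **ESSENTIAL SURJECTIVITY of `Λ ↦ ℍ/Λ` onto the objects of `HolRS` over `ℍ/Γ`**: for every
`p : Y ⟶ ℍ/Γ` there are `Λ ≤ Γ` of finite index, acting freely and properly discontinuously (so that
`fuchsianQuotient Λ` is defined), and an ISOMORPHISM `e : fuchsianQuotient Λ ≅ Y` of `HolRS` OVER `ℍ/Γ`,
`p (e [τ]_Λ) = [τ]_Γ` — «the full subcategory of `EA` consisting of objects that map to `X` may … be
identified with … `Loc_R(X)`», objects half, at the uniformised model.  Holomorphy of `e`: descent of the
holomorphic lift `k = e ∘ [·]_Λ`; of `e⁻¹`: a bijective holomorphic local homeomorphism of Riemann surfaces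
is a biholomorphism. [cite: MochizukiAbsTopIII2015, Proposition 4.2 (i) proof p.106] -/
theorem exists_fuchsianQuotient_iso_of_hom :
    ∃ (Λ : Subgroup SL(2, ℝ)) (_ : Λ ≤ Γ) (_ : ProperlyDiscontinuousSMul Λ ℍ) (_ : IsCancelSMul Λ ℍ),
      (Λ.subgroupOf Γ).FiniteIndex ∧ ∃ e : fuchsianQuotient Λ ≅ Y,
        ∀ τ : ℍ, p.toFun (e.hom.toFun (Quotient.mk (orbitRel Λ ℍ) τ)) = Quotient.mk (orbitRel Γ ℍ) τ := by
  obtain ⟨Λ, k, e, hΛΓ, hfin, hk, dk, hpk, -, -, hek⟩ := exists_subgroup_cover_of_hom Γ Y p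
  haveI hPD : ProperlyDiscontinuousSMul Λ ℍ :=
    Subgroup.properlyDiscontinuousSMul_of_le ‹ProperlyDiscontinuousSMul Γ ℍ› hΛΓ
  haveI hC : IsCancelSMul Λ ℍ := isCancelSMul_of_le upperHalfPlane Γ hΛΓ
  refine ⟨Λ, hΛΓ, hPD, hC, hfin, ?_⟩
  -- `e` read on the carrier of `fuchsianQuotient Λ`
  let e' : (fuchsianQuotient Λ).carrier ≃ₜ Y.carrier := e
  have he' : ∀ τ : ℍ, e' (Quotient.mk (orbitRel Λ ℍ) τ) = k τ := hek
  -- holomorphy of `e` by descent along `ℍ → ℍ/Λ`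
  have hsmoothΛ : ∀ g : Λ, ContMDiff 𝓘(ℂ, ℂ) 𝓘(ℂ, ℂ) ω (fun x : ℍ => g • x) :=
    fun g => contMDiff_sl_smul (g : SL(2, ℝ))
  have hcomp : MDifferentiable 𝓘(ℂ, ℂ) 𝓘(ℂ, ℂ)
      ((⇑e' : (fuchsianQuotient Λ).carrier → Y.carrier) ∘ QuotientManifold.mk (G := Λ) (M := ℍ)) := by
    have : (⇑e' : (fuchsianQuotient Λ).carrier → Y.carrier) ∘ QuotientManifold.mk (G := Λ) (M := ℍ) = k :=
      funext he'
    rw [this]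
    exact dk
  have de : MDifferentiable 𝓘(ℂ, ℂ) 𝓘(ℂ, ℂ) (⇑e' : (fuchsianQuotient Λ).carrier → Y.carrier) :=
    (QuotientManifold.mdifferentiable_comp_mk_iff (G := Λ) (M := ℍ) (N := Y.carrier) hsmoothΛ
      (by simp)).mp hcomp
  -- `e` is a bijective holomorphic local homeomorphism, hence a biholomorphism
  have hloc : IsLocalDiffeomorph 𝓘(ℂ, ℂ) 𝓘(ℂ, ℂ) ω (⇑e' : (fuchsianQuotient Λ).carrier → Y.carrier) :=
    isLocalDiffeomorph_of_mdifferentiable_of_isLocalHomeomorph de e'.isLocalHomeomorph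
  let D : Diffeomorph 𝓘(ℂ, ℂ) 𝓘(ℂ, ℂ) (fuchsianQuotient Λ).carrier Y.carrier ω :=
    hloc.diffeomorphOfBijective e'.bijective
  have hD : ∀ x, D x = e' x := fun _ => rfl
  have desymm : MDifferentiable 𝓘(ℂ, ℂ) 𝓘(ℂ, ℂ) (⇑e'.symm : Y.carrier → (fuchsianQuotient Λ).carrier) := by
    have : (⇑e'.symm : Y.carrier → (fuchsianQuotient Λ).carrier) = ⇑D.symm := by
      funext y
      apply e'.injective
      rw [e'.apply_symm_apply, ← hD]
      exact (D.apply_symm_apply y).symm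
    rw [this]
    exact D.symm.contMDiff.mdifferentiable (by simp)
  -- finite étale: `e`, `e⁻¹` are homeomorphisms
  have hcov : IsCoveringMap (⇑e' : (fuchsianQuotient Λ).carrier → Y.carrier) :=
    IsFiniteEtale.id.isCoveringMap.homeomorph_comp e'
  have hcov' : IsCoveringMap (⇑e'.symm : Y.carrier → (fuchsianQuotient Λ).carrier) :=
    IsFiniteEtale.id.isCoveringMap.homeomorph_comp e'.symm
  let ehom : fuchsianQuotient Λ ⟶ Y :=
    { toFun := e'
      mdifferentiable := de
      isFiniteEtale := ⟨hcov, fun y => (Set.finite_singleton y).preimage e'.injective.injOn⟩ }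
  let einv : Y ⟶ fuchsianQuotient Λ :=
    { toFun := e'.symm
      mdifferentiable := desymm
      isFiniteEtale := ⟨hcov', fun x => (Set.finite_singleton x).preimage e'.symm.injective.injOn⟩ }
  refine ⟨⟨ehom, einv, hom_ext (funext fun x => e'.symm_apply_apply x),
    hom_ext (funext fun y => e'.apply_symm_apply y)⟩, fun τ => ?_⟩
  show p.toFun (e' (Quotient.mk _ τ)) = _
  rw [he', hpk]

end HolRS

end Literature.AnabelianGeometry.AbsoluteAnabelian
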